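import Mathlib.Analysis.InnerProductSpace.Rayleigh
import Literature.MathematicalPhysics.QuantumLattice.TransferOperatorPerron
import HarnessLib

/-!
# The transfer operator of an injective MPS tensor: norm bounds, trace duality, left eigenvector

Second helper file (after `TransferOperatorPerron.lean`) towards the discharge of
`Literature.MathematicalPhysics.QuantumLattice.fannes_nachtergaele_werner_decay`
(`LiebRobinson.lean`). Theorems only; no definition, no named fact.

* **Loewner order vs. L²-operator norm** (`Mathlib.Analysis.Matrix.Order`, scoped `MatrixOrder`;
  norm scoped `Matrix.Norms.L2Operator`): `l2_opNorm_le_of_abs_re_le` (a Hermitian matrix with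
  `|Re x⋆Ex| ≤ M x⋆x` has `‖E‖ ≤ M`, via Mathlib's Rayleigh-quotient formula for the norm of a
  symmetric operator), `posSemidef_norm_smul_one_sub/add` (`-‖H‖ ≤ H ≤ ‖H‖`),
  `norm_le_of_posSemidef_sub_add`, `norm_le_of_loewner_sandwich`
  (`-w X₀ ≤ E ≤ w X₀ ⇒ ‖E‖ ≤ w ‖X₀‖`).
* **Traces**: `re_trace_mul_nonneg` (`Re Tr (P Q) ≥ 0` for `P, Q ≥ 0`),
  `im_trace_mul_of_isHermitian`, `re_trace_mul_pos`, `norm_trace_mul_le_of_posSemidef`.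
* **The adjoint tensor** `i ↦ (A^i)†`: `wordProduct_conjTranspose_tensor`,
  `IsInjectiveMPS.conjTranspose_tensor` (injectivity is inherited), the trace duality
  `Tr (Y 𝔼(X)) = Tr (𝔼†(Y) X)` (`trace_mul_transferOp`) and the **left Perron–Frobenius
  eigenvector** `IsInjectiveMPS.exists_posDef_left_eigenvector`: `𝔼†(Y₀) = r₀ Y₀` with `Y₀ > 0` and
  the same `r₀` as the right eigenvector `𝔼(X₀) = r₀ X₀` of `TransferOperatorPerron`.

## Sources

* M. Fannes, B. Nachtergaele, R. F. Werner, *Finitely correlated states on quantum spin chains*,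
  Comm. Math. Phys. **144** (1992) 443–490, §2 (the pair `(𝔼, ρ)`), §3 Prop. 3.1 and the remark
  following it ("the adjoint of `𝔼` has the same spectrum … `ρ` is the unique left eigenvector").
  [FannesNachtergaeleWernerCMP1992]
* D. Perez-Garcia, F. Verstraete, M. M. Wolf, J. I. Cirac, Quantum Inf. Comput. **7** (2007) 401,
  §3.2 (injectivity). [PerezGarciaVerstraeteWolfCiracQIC2007]
* D. E. Evans, R. Høegh-Krohn, J. London Math. Soc. (2) **17** (1978) 345, §2 (Perron–Frobenius
  for positive maps).

Mathlib: `ContinuousLinearMap.norm_eq_iSup_rayleighQuotient`, `Matrix.toEuclideanCLM`,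
`Matrix.isSymmetric_toEuclideanLin_iff`, `Matrix.conjTranspose_list_prod`; from the tree
`norm_star_dotProduct_mulVec_le`, `norm_trace_mul_le_opNorm_mul_re_trace`
(`TraceInequalitiesProofs`) and `TransferOperatorPerron`.
-/

noncomputable section

open Matrix Filter Topology
open scoped ComplexOrder MatrixOrder Matrix.Norms.L2Operator

namespace Literature.MathematicalPhysics.QuantumLattice

section QLattice

variable {q D : ℕ}

/-! ### Norm bounds from the Loewner order -/

section Loewner

variable {n : Type*} [Fintype n] [DecidableEq n]

/-- `Re ⟨E x, x⟩ = Re (x⋆ ⬝ E x)` for the Euclidean operator of a matrix. [folklore] -/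
theorem re_inner_toEuclideanCLM (E : Matrix n n ℂ) (x : EuclideanSpace ℂ n) :
    RCLike.re (inner ℂ (toEuclideanCLM (n := n) (𝕜 := ℂ) E x) x) =
      (star x.ofLp ⬝ᵥ E *ᵥ x.ofLp).re := by
  rw [EuclideanSpace.inner_eq_star_dotProduct, Matrix.ofLp_toEuclideanCLM, dotProduct_comm,
    star_dotProduct]
  exact Complex.conj_re _

omit [DecidableEq n] in
/-- `‖x‖² = Re (x⋆ ⬝ x)` on Euclidean space. [folklore] -/
theorem norm_sq_eq_re_star_dotProduct (x : EuclideanSpace ℂ n) :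
    ‖x‖ ^ 2 = (star x.ofLp ⬝ᵥ x.ofLp).re := by
  rw [← inner_self_eq_norm_sq (𝕜 := ℂ), EuclideanSpace.inner_eq_star_dotProduct, dotProduct_comm]
  rfl

/-- **Operator norm of a Hermitian matrix from its quadratic form**: if `|Re (x⋆ E x)| ≤ M x⋆x`
for all `x` then `‖E‖ ≤ M` (L²-operator norm; the norm of a symmetric operator is the supremum
of its Rayleigh quotients, Mathlib `ContinuousLinearMap.norm_eq_iSup_rayleighQuotient`).
[folklore] -/
theorem l2_opNorm_le_of_abs_re_le {E : Matrix n n ℂ} (hE : E.IsHermitian) {M : ℝ} (hM : 0 ≤ M)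
    (h : ∀ x : n → ℂ, |(star x ⬝ᵥ E *ᵥ x).re| ≤ M * (star x ⬝ᵥ x).re) : ‖E‖ ≤ M := by
  rw [cstar_norm_def]
  set T := toEuclideanCLM (n := n) (𝕜 := ℂ) E with hTdef
  have hT : (T : EuclideanSpace ℂ n →ₗ[ℂ] EuclideanSpace ℂ n).IsSymmetric := by
    rw [hTdef, Matrix.coe_toEuclideanCLM_eq_toEuclideanLin]
    exact Matrix.isSymmetric_toEuclideanLin_iff.mpr hE
  rw [ContinuousLinearMap.norm_eq_iSup_rayleighQuotient T hT]
  refine ciSup_le fun x => ?_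
  rw [ContinuousLinearMap.rayleighQuotient, ContinuousLinearMap.reApplyInnerSelf_apply, abs_div,
    abs_sq]
  by_cases hx : x = 0
  · simp [hx, hM]
  rw [div_le_iff₀ (by positivity), hTdef, re_inner_toEuclideanCLM, norm_sq_eq_re_star_dotProduct]
  exact h _

/-- `H ≤ ‖H‖·1` for a Hermitian matrix (Loewner order, L²-operator norm). [folklore] -/
theorem posSemidef_norm_smul_one_sub {H : Matrix n n ℂ} (hH : H.IsHermitian) :
    ((‖H‖ : ℂ) • (1 : Matrix n n ℂ) - H).PosSemidef := by
  refine posSemidef_of_re_nonneg ((isHermitian_real_smul isHermitian_one _).sub hH) fun x => ?_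
  rw [sub_mulVec, dotProduct_sub, smul_mulVec, one_mulVec, dotProduct_smul, smul_eq_mul,
    Complex.sub_re, Complex.re_ofReal_mul]
  have h1 := norm_star_dotProduct_mulVec_le H x
  have h2 := Complex.abs_re_le_norm (star x ⬝ᵥ H *ᵥ x)
  linarith [le_abs_self ((star x ⬝ᵥ H *ᵥ x).re)]

/-- `-‖H‖·1 ≤ H` for a Hermitian matrix (Loewner order, L²-operator norm). [folklore] -/
theorem posSemidef_norm_smul_one_add {H : Matrix n n ℂ} (hH : H.IsHermitian) :
    ((‖H‖ : ℂ) • (1 : Matrix n n ℂ) + H).PosSemidef := by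
  refine posSemidef_of_re_nonneg ((isHermitian_real_smul isHermitian_one _).add hH) fun x => ?_
  rw [add_mulVec, dotProduct_add, smul_mulVec, one_mulVec, dotProduct_smul, smul_eq_mul,
    Complex.add_re, Complex.re_ofReal_mul]
  have h1 := norm_star_dotProduct_mulVec_le H x
  have h2 := Complex.abs_re_le_norm (star x ⬝ᵥ H *ᵥ x)
  linarith [neg_abs_le ((star x ⬝ᵥ H *ᵥ x).re)]

/-- `-M·1 ≤ E ≤ M·1 ⇒ ‖E‖ ≤ M` for Hermitian `E`. [folklore] -/
theorem norm_le_of_posSemidef_sub_add {E : Matrix n n ℂ} (hE : E.IsHermitian) {M : ℝ}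
    (hM : 0 ≤ M) (h₁ : ((M : ℂ) • (1 : Matrix n n ℂ) - E).PosSemidef)
    (h₂ : ((M : ℂ) • (1 : Matrix n n ℂ) + E).PosSemidef) : ‖E‖ ≤ M := by
  refine l2_opNorm_le_of_abs_re_le hE hM fun x => ?_
  have a := h₁.re_dotProduct_nonneg x
  have b := h₂.re_dotProduct_nonneg x
  rw [RCLike.re_to_complex] at a b
  rw [sub_mulVec, dotProduct_sub, smul_mulVec, one_mulVec, dotProduct_smul, smul_eq_mul,
    Complex.sub_re, Complex.re_ofReal_mul] at a
  rw [add_mulVec, dotProduct_add, smul_mulVec, one_mulVec, dotProduct_smul, smul_eq_mul,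
    Complex.add_re, Complex.re_ofReal_mul] at b
  rw [abs_le]
  constructor <;> linarith

/-- **Norm from a two-sided Loewner bound**: `-w X₀ ≤ E ≤ w X₀` with `X₀ ≥ 0`, `w ≥ 0` and `E`
Hermitian gives `‖E‖ ≤ w ‖X₀‖`. [folklore] -/
theorem norm_le_of_loewner_sandwich {E X₀ : Matrix n n ℂ} (hE : E.IsHermitian)
    (hX₀ : X₀.PosSemidef) {w : ℝ} (hw : 0 ≤ w) (h₁ : ((w : ℂ) • X₀ - E).PosSemidef)
    (h₂ : ((w : ℂ) • X₀ + E).PosSemidef) : ‖E‖ ≤ w * ‖X₀‖ := by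
  have hX : ((‖X₀‖ : ℂ) • (1 : Matrix n n ℂ) - X₀).PosSemidef := posSemidef_norm_smul_one_sub hX₀.1
  have hwX : (((w * ‖X₀‖ : ℝ) : ℂ) • (1 : Matrix n n ℂ) - (w : ℂ) • X₀).PosSemidef := by
    have := hX.smul (Complex.zero_le_real.mpr hw)
    rwa [smul_sub, smul_smul, ← Complex.ofReal_mul] at this
  refine norm_le_of_posSemidef_sub_add hE (by positivity) ?_ ?_
  · have := hwX.add h₁
    rwa [sub_add_sub_cancel] at this
  · convert hwX.add h₂ using 1
    abel

end Loewner

/-! ### Traces of products of positive matrices -/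

section Traces

variable {n : Type*} [Fintype n] [DecidableEq n]

/-- `Re Tr (P Q) ≥ 0` for positive semidefinite `P, Q` (`Tr (P Bᴴ B) = Tr (B P Bᴴ) ≥ 0`).
[folklore] -/
theorem re_trace_mul_nonneg {P Q : Matrix n n ℂ} (hP : P.PosSemidef) (hQ : Q.PosSemidef) :
    0 ≤ ((P * Q).trace).re := by
  obtain ⟨B, rfl⟩ := CStarAlgebra.nonneg_iff_eq_star_mul_self.mp hQ.nonneg
  rw [star_eq_conjTranspose, ← Matrix.mul_assoc, trace_mul_cycle]
  exact (Complex.nonneg_iff.mp (hP.mul_mul_conjTranspose_same B).trace_nonneg).1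

omit [DecidableEq n] in
/-- `Tr (Y H)` is real for Hermitian `Y, H`. [folklore] -/
theorem im_trace_mul_of_isHermitian {Y H : Matrix n n ℂ} (hY : Y.IsHermitian)
    (hH : H.IsHermitian) : ((Y * H).trace).im = 0 := by
  have h : star ((Y * H).trace) = (Y * H).trace := by
    rw [← trace_conjTranspose, conjTranspose_mul, hY.eq, hH.eq, trace_mul_comm]
  exact Complex.conj_eq_iff_im.mp h

/-- `Re Tr (Y X) > 0` for `Y > 0` positive definite and `X ≥ 0` non-zero. [folklore] -/
theorem re_trace_mul_pos {Y X : Matrix n n ℂ} (hY : Y.PosDef) (hX : X.PosSemidef) (hX0 : X ≠ 0) :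
    0 < ((Y * X).trace).re := by
  obtain ⟨lam, hlam, hpsd⟩ := exists_pos_sub_smul_posSemidef hY isHermitian_one
  have h1 : 0 ≤ (((Y - (lam : ℂ) • (1 : Matrix n n ℂ)) * X).trace).re := re_trace_mul_nonneg hpsd hX
  have h2 : 0 < X.trace.re := trace_re_pos_of_posSemidef hX hX0
  rw [sub_mul, trace_sub, smul_mul_assoc, one_mul, trace_smul, smul_eq_mul, Complex.sub_re,
    Complex.re_ofReal_mul] at h1
  nlinarith

/-- `|Tr (Y X)| ≤ ‖X‖ · Re Tr Y` for `Y ≥ 0` (L²-operator norm). [folklore] -/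
theorem norm_trace_mul_le_of_posSemidef {Y : Matrix n n ℂ} (hY : Y.PosSemidef)
    (X : Matrix n n ℂ) : ‖(Y * X).trace‖ ≤ ‖X‖ * (Y.trace).re := by
  rw [trace_mul_comm]
  exact norm_trace_mul_le_opNorm_mul_re_trace X hY

end Traces

/-! ### The adjoint tensor and trace duality -/

/-- Reversing a tuple reverses the list of its values. [folklore] -/
theorem ofFn_comp_rev {α : Type*} {m : ℕ} (f : Fin m → α) :
    List.ofFn (f ∘ Fin.rev) = (List.ofFn f).reverse := by
  apply List.ext_getElem
  · simp
  · intro i h₁ h₂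
    simp only [List.getElem_ofFn, Function.comp_apply, List.getElem_reverse, List.length_ofFn]
    congr 1
    ext
    simp only [Fin.val_rev]
    simp only [List.length_ofFn] at h₁
    omega

/-- The word products of the adjoint tensor `i ↦ (A^i)†` are the adjoints of the reversed word
products of `A`. [folklore] -/
theorem wordProduct_conjTranspose_tensor (A : MPSTensor q D) {ℓ : ℕ} (w : Fin ℓ → Fin q) :
    wordProduct (fun i => (A i)ᴴ) w = (wordProduct A (w ∘ Fin.rev))ᴴ := by
  unfold wordProduct
  rw [conjTranspose_list_prod, List.map_ofFn, ← ofFn_comp_rev]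
  refine congrArg List.prod (congrArg List.ofFn (funext fun i => ?_))
  simp [Fin.rev_rev]

/-- **Injectivity passes to the adjoint tensor**: if the words of length `ℓ` of `A` span `M_D(ℂ)`
then so do those of `i ↦ (A^i)†` (they are the adjoints of the reversed words, and `X ↦ Xᴴ` is a
conjugate-linear bijection). Perez-Garcia–Verstraete–Wolf–Cirac (2007) §3.2.
[cite: PerezGarciaVerstraeteWolfCiracQIC2007, §3.2] -/
theorem IsInjectiveMPS.conjTranspose_tensor {A : MPSTensor q D} {ℓ : ℕ} (h : IsInjectiveMPS A ℓ) :
    IsInjectiveMPS (fun i => (A i)ᴴ) ℓ := by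
  unfold IsInjectiveMPS at h ⊢
  have key : ∀ Y ∈ Submodule.span ℂ (Set.range (wordProduct (ℓ := ℓ) A)),
      Yᴴ ∈ Submodule.span ℂ (Set.range (wordProduct (ℓ := ℓ) fun i => (A i)ᴴ)) := by
    intro Y hY
    induction hY using Submodule.span_induction with
    | mem x hx =>
      obtain ⟨w, rfl⟩ := hx
      refine Submodule.subset_span ⟨w ∘ Fin.rev, ?_⟩
      rw [wordProduct_conjTranspose_tensor]
      congr 2
      funext i
      simp [Fin.rev_rev]
    | zero => simp
    | add x y _ _ hx hy =>
      rw [conjTranspose_add]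
      exact add_mem hx hy
    | smul c x _ hx =>
      rw [conjTranspose_smul]
      exact Submodule.smul_mem _ _ hx
  rw [eq_top_iff]
  intro X _
  have hX : Xᴴ ∈ Submodule.span ℂ (Set.range (wordProduct (ℓ := ℓ) A)) := by
    rw [h]; exact Submodule.mem_top
  simpa using key _ hX

/-- **Trace duality** `Tr (Y 𝔼(X)) = Tr (𝔼†(Y) X)`, where `𝔼†(Y) = Σ_i (A^i)† Y A^i` is the transfer
operator of the adjoint tensor (the Heisenberg-picture map). Fannes–Nachtergaele–Werner (1992)
§2 (the dual pair `(𝔼, ρ)`). [cite: FannesNachtergaeleWernerCMP1992, §2] -/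
theorem trace_mul_transferOp (A : MPSTensor q D) (Y X : Matrix (Fin D) (Fin D) ℂ) :
    (Y * transferOp A X).trace = (transferOp (fun i => (A i)ᴴ) Y * X).trace := by
  simp only [transferOp_apply, conjTranspose_conjTranspose, Finset.mul_sum, Finset.sum_mul,
    trace_sum]
  refine Finset.sum_congr rfl fun i _ => ?_
  rw [← Matrix.mul_assoc, ← Matrix.mul_assoc, trace_mul_cycle, ← Matrix.mul_assoc]

/-- **Left Perron–Frobenius eigenvector.** For an injective tensor (`0 < ℓ`, `D > 0`) with right
Perron eigenvector `𝔼(X₀) = r₀ X₀`, `X₀ > 0`, the adjoint map `𝔼†` has a positive definite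
eigenvector `Y₀` with the *same* eigenvalue: `𝔼†(Y₀) = r₀ Y₀` (apply the Perron–Frobenius theorem
to the adjoint tensor and compare `Tr (Y₀ 𝔼 X₀) = r₀ Tr (Y₀ X₀) = s₀ Tr (Y₀ X₀)` with
`Tr (Y₀ X₀) > 0`). Evans–Høegh-Krohn (1978) §2; Fannes–Nachtergaele–Werner (1992) §3 (after
Prop. 3.1: "the adjoint of `𝔼` has the same spectrum … `ρ` is the unique left eigenvector").
[cite: FannesNachtergaeleWernerCMP1992, §3 Prop. 3.1] -/
theorem IsInjectiveMPS.exists_posDef_left_eigenvector [NeZero D] {A : MPSTensor q D} {ℓ : ℕ}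
    (h : IsInjectiveMPS A ℓ) (hℓ : 0 < ℓ) {r₀ : ℝ} {X₀ : Matrix (Fin D) (Fin D) ℂ}
    (hX₀ : X₀.PosDef) (hTX₀ : transferOp A X₀ = (r₀ : ℂ) • X₀) :
    ∃ Y₀ : Matrix (Fin D) (Fin D) ℂ, Y₀.PosDef ∧
      transferOp (fun i => (A i)ᴴ) Y₀ = (r₀ : ℂ) • Y₀ := by
  obtain ⟨s₀, -, Y₀, hY₀, hTY₀⟩ := h.conjTranspose_tensor.exists_posDef_eigenvector hℓ
  have hX₀0 : X₀ ≠ 0 := by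
    intro h0
    have := hX₀.trace_pos
    rw [h0, trace_zero] at this
    exact lt_irrefl _ this
  have hc : (Y₀ * X₀).trace ≠ 0 := by
    intro h0
    have := re_trace_mul_pos hY₀ hX₀.posSemidef hX₀0
    rw [h0, Complex.zero_re] at this
    exact lt_irrefl _ this
  have e := trace_mul_transferOp A Y₀ X₀
  rw [hTX₀, hTY₀, Matrix.mul_smul, Matrix.smul_mul, trace_smul, trace_smul, smul_eq_mul,
    smul_eq_mul] at e
  have hrs : (r₀ : ℂ) = s₀ := mul_right_cancel₀ hc e
  exact ⟨Y₀, hY₀, by rw [hTY₀, hrs]⟩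

end QLattice

end Literature.MathematicalPhysics.QuantumLattice
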